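import Summits.QuantumFields.BalabanUV.Beta.D1BFx.GramWeightJetsMixed
import Summits.QuantumFields.BalabanUV.Beta.D1BFx.TorusZerothJunction
import Summits.QuantumFields.BalabanUV.Beta.D1BFx.TorusGaugeBasisTranspose
import Summits.QuantumFields.BalabanUV.Beta.D1BFx.TorusGaugeBasisKernel

/-!
# `BalabanUV.Beta.D1BFx.KTransferTorus` — road «BF-x» for binder row D1, slot (K), `K-ASSEMBLY-SPEC-v2.md` §4 brick **TB5-1: THE PER-TORUS TRANSFER
# IDENTITY OF ROUTE T UNDER (R2)** (ruling ρ-g6-12): on every coarse torus, with the B-INDEPENDENT comb-slice gauge basis `Ŵ₀ = TorusGaugeBasis.What0`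
# (all `W`-jets zero), the canonical co-frame weight datum `(T₀, A₀)` of a block-mean-free basis `N` with `Ŵ₀ = D̂ₛN`, and ANY jet tables
# `Kₛ Kₜ Kₛₜ` ∕ `Qₛ Qₜ Qₛₜ` satisfying the KINEMATIC Ward letters `· * Ŵ₀ = 0` and ANY weight jets `Tₛ Tₜ Tₛₜ` ∕ `Aₛ Aₜ Aₛₜ`:
#   `hessT (M_T⁻¹|_{ν⊕μ}; kkt Kₛ Qₛ, kkt Kₜ Qₜ, kkt Kₛₜ Qₛₜ) + hessT ((Ŵ₀ᵀB₀Ŵ₀)⁻¹; Ŵ₀ᵀBₛŴ₀, Ŵ₀ᵀBₜŴ₀, Ŵ₀ᵀBₛₜŴ₀)`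
#   `= hessT (blocksHat p (sortK (m+1) (NlegRoad m a)); kkt (Kₛ+Bₛ) Qₛ, kkt (Kₜ+Bₜ) Qₜ, kkt (Kₛₜ+Bₛₜ) Qₛₜ)`
# (`B₀ = T₀ᵀA₀T₀`, `Bₛ = gram₁ T₀ Tₛ A₀ Aₛ`, `Bₜ`, `Bₛₜ = gramMix T A`) — gan24-leaf-03-g44's K-TA4G `GramWeightJetsMixed.hessT_gramTransfer_jets`
# with EVERY zeroth-order hypothesis a NAMED tree fact (`hτ`, (a0), (b0): leaf-03-g8 `TorusGaugeBasis`; (a0t): ne7b-leaf-01-g21 `TorusGaugeBasisTranspose`;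
# `hT`, `hA`, `N₀ = N_T`, `N₀⁻¹`: `TorusZerothJunction`; `hM`: TB1 `TorusCombKKT.isUnit_det_MT`; basis facts: ne9-leaf-09-g38 `TorusGaugeBasisKernel`), the `2·hessT (τŴ)`-term
# VANISHING (`τ_TŴ₀ = 1`, no `W`-jets)

HONEST FRAMING (cell contract, verbatim): «discharging `BetaPertH` makes Bałaban's UV stability UNCONDITIONAL — a real constructive-QFT
result; it is NOT the continuum limit and NOT the Clay problem.»  HONEST DEPENDENCY (verbatim): «continuum YM on T⁴ ⇐ BetaPertH ∧ nine
spine estimates (0/9 proved); BetaPertH ⇐ (D1) ∧ (D4) ∧ CAP+tail; G-an2-4 gates asym, D1 and NE2/3/4.»  THIS MODULE DISCHARGES NOTHING of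
D1 / BetaPertH: [folklore] one instantiation BY NAME.  No `def`, no `def … : Prop`, nothing cited, 0 sorry.  DISPLAYED (what the (K) chain still
owes on each torus): the basis facts `hN` ∕ `hNinj` ∕ `hW` («K-TB3b-N»), the table jets with their kinematic Ward letters (TB4 (T1) ∕ (T2-kin)), the
weight jets (free here; «TB4-W» names them), the decay `Spr (Ga (m+1) a)` (printed [B5, Prop. 1.2] ∧ [(1.126)–(1.127)], `GluonLegTails.spr_Ga_of_prop12`).
The adoption of (R2) (B-independent basis, kinematic letters) is the owner's ruling ρ-g6-12 on an1-g33's WARD2 test; the (R1)∕(R2) fork is the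
row-D1 owner's.  NOT summit progress; NOT BetaPertH, NOT continuum, NOT Clay.

ABSOLUTE RULE (cell, verbatim): «No internally-minted statement may enter as a cited fact. Every hypothesis is either kernel-proved in this
package or a verbatim quotation of a PUBLISHED theorem with page reference. The manuscript(s) under audit are NOT citable for their own
disputed steps — they are the thing under adjudication; programme-internal (2001/route/tribunal) claims are never citable.»

CONTENT (`m`, `a > 0`, coarse period `p`, in-block root `r ∈ box 4 (m+1)`; sorted currency `ν = I 3 (m+1) p`, `μ = J 3 p`, comb rows
`ρ_T = CombRows (toSite r) (m+1) p`; all [folklore]).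
* §1 small algebra: `gram₁_zero_basis` (`gram₁ W 0 B₀ B₁ = WᵀB₁W`), `gramMix_zero_basis`, `hessT_zero_jets` (`hessT L 0 0 0 = 0`).
* §2 **`hessT_transfer_road`** — the identity above, for ANY block-mean-free basis `N` with `Ŵ₀ = D̂ₛN` (`hN`, `hNinj`, `hW` displayed).
* §3 **`hessT_transfer_road_Nhat`** — the same at `N := TorusGaugeBasisMatrix.Nhat` with the basis facts DISCHARGED by ne9-leaf-09-g38's «K-TB3b-N»
  `TorusGaugeBasisKernel` (`Nhat_range`, `Nhat_injective`, `What0_eq_DhatS_mul_Nhat`): only the table jets + kinematic letters, the weight jets and `Spr Ga` remain displayed.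
Unit `b2b-balaban-beta-d1-p2` (road owner, gen 6).
-/

noncomputable section

namespace Summit.QuantumFields.BalabanUV.Beta.D1BFx.KTransferTorus

open Matrix
open scoped BigOperators
open Literature.MathematicalPhysics.QuantumFieldTheory.Balaban1983to89
open Literature.MathematicalPhysics.QuantumFieldTheory.Balaban1983to89.Beta
open Literature.MathematicalPhysics.QuantumFieldTheory.Balaban1983to89.Beta.Composition (kkt)
open AffineAveraging (box toSite)
open Summit.QuantumFields.BalabanUV.Beta.TameKernelCalculus (Spr)
open Summit.QuantumFields.BalabanUV.Beta.D1BFx.SortedKernels (blocksHat)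
open Summit.QuantumFields.BalabanUV.Beta.D1BFx.SortedPack (sortK)
open Summit.QuantumFields.BalabanUV.Beta.D1BFx.TorusCombKKT (I J CombRows tauT Khat Qhat isUnit_det_MT)
open Summit.QuantumFields.BalabanUV.Beta.D1BFx.TorusGaugeBasis (What0 tauT_mul_What0 Khat_mul_What0 Qhat_mul_What0)
open Summit.QuantumFields.BalabanUV.Beta.D1BFx.TorusGaugeBasisTranspose (Khat_transpose_mul_What0)
open Summit.QuantumFields.BalabanUV.Beta.D1BFx.PeriodisedProjector (Lhat Shat)
open Summit.QuantumFields.BalabanUV.Beta.D1BFx.TorusHodgeWeight (DhatS)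
open Summit.QuantumFields.BalabanUV.Beta.D1BFx.TorusZerothJunction (det_coframe_mul_basis_road_ne_zero det_weightA_road_ne_zero
  inv_kkt_gram_eq_blocksHat)
open Summit.QuantumFields.BalabanUV.Beta.D1BFx.MixedVarPackedHess (hessT)
open Summit.QuantumFields.BalabanUV.Beta.D1BFx.GramWeightJets (gram₀ gram₁)
open Summit.QuantumFields.BalabanUV.Beta.D1BFx.GramWeightJetsMixed (gramMix hessT_gramTransfer_jets)
open Summit.QuantumFields.BalabanUV.Beta.D1BFx.RWeightedLegPack (NlegRoad)
open Summit.QuantumFields.BalabanUV.Beta.D1BFx.TorusGaugeBasisMatrix (Nhat)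
open Summit.QuantumFields.BalabanUV.Beta.D1BFx.TorusGaugeBasisKernel (Nhat_range Nhat_injective What0_eq_DhatS_mul_Nhat)

/-! ## §1 Small algebra: Gram jets with a constant basis, `hessT` with zero jets -/

section Algebra

variable {ι κ : Type*} [Fintype ι] [Fintype κ]

omit [Fintype κ] in
/-- [folklore] With a constant basis (`W₁ = 0`) the first Gram jet is `WᵀB₁W`. -/
theorem gram₁_zero_basis (W : Matrix ι κ ℝ) (B₀ B₁ : Matrix ι ι ℝ) : gram₁ W 0 B₀ B₁ = Wᵀ * B₁ * W := by
  simp [gram₁]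

omit [Fintype κ] in
/-- [folklore] With a constant basis the mixed second Gram jet is `WᵀBₛₜW`. -/
theorem gramMix_zero_basis (W : Matrix ι κ ℝ) (B₀ Bₛ Bₜ Bₛₜ : Matrix ι ι ℝ) : gramMix W 0 0 0 B₀ Bₛ Bₜ Bₛₜ = Wᵀ * Bₛₜ * W := by
  simp [gramMix]

omit [Fintype κ] in
/-- [folklore] `gram₀ W B = WᵀBW` (by `rfl`). -/
theorem gram₀_eq (W : Matrix ι κ ℝ) (B : Matrix ι ι ℝ) : gram₀ W B = Wᵀ * B * W := rfl

omit [Fintype κ] in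
/-- [folklore] `hessT L 0 0 0 = 0`. -/
theorem hessT_zero_jets (L : Matrix ι ι ℝ) : hessT L 0 0 0 = 0 := by
  simp [hessT]

end Algebra

/-! ## §2 The per-torus transfer identity of route T under (R2) -/

variable (m : ℕ) {a : ℝ} (p : ℕ) [NeZero p] {r : Fin 4 → ℕ}

/-- [folklore] **TB5-1: THE PER-TORUS TRANSFER IDENTITY OF ROUTE T (R2).**  For the B-independent comb-slice gauge basis `Ŵ₀ = What0`, a
block-mean-free basis `N` with `Ŵ₀ = D̂ₛ·N`, table jets killing `Ŵ₀` (kinematic Ward letters) and arbitrary weight jets: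
`hessT (M_T⁻¹|_{ν⊕μ}; M-jets) + hessT ((Ŵ₀ᵀB₀Ŵ₀)⁻¹; Ŵ₀ᵀB·Ŵ₀) = hessT (blocksHat p (sortK (m+1) (NlegRoad m a)); N-jets)` with `B₀ = T₀ᵀA₀T₀`,
`T₀ = NᵀL̂D̂ₛᵀ`, `A₀ = 2•(NᵀL̂L̂N)⁻¹`, `Bₛ = gram₁ T₀ Tₛ A₀ Aₛ`, `Bₜ = gram₁ T₀ Tₜ A₀ Aₜ`, `Bₛₜ = gramMix T₀ Tₛ Tₜ Tₛₜ A₀ Aₛ Aₜ Aₛₜ`. -/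
theorem hessT_transfer_road (ha : 0 < a) (hGa : Spr (GluonLeg.Ga (m + 1) a)) (hr : r ∈ box 4 (m + 1))
    {N : Matrix (Site 4 ((m + 1) * p)) (CombRows (toSite r) (m + 1) p) ℝ}
    (hN : ∀ lam : Site 4 ((m + 1) * p) → ℝ, Shat m ((m + 1) * p) *ᵥ lam = 0 ↔ ∃ c : CombRows (toSite r) (m + 1) p → ℝ, lam = N *ᵥ c)
    (hNinj : Function.Injective N.mulVec) (hW : What0 r (m + 1) p = DhatS m p * N)
    (Kₛ Kₜ Kₛₜ : Matrix (I 3 (m + 1) p) (I 3 (m + 1) p) ℝ) (Qₛ Qₜ Qₛₜ : Matrix (J 3 p) (I 3 (m + 1) p) ℝ)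
    (Tₛ Tₜ Tₛₜ : Matrix (CombRows (toSite r) (m + 1) p) (I 3 (m + 1) p) ℝ)
    (Aₛ Aₜ Aₛₜ : Matrix (CombRows (toSite r) (m + 1) p) (CombRows (toSite r) (m + 1) p) ℝ)
    (kₛ : Kₛ * What0 r (m + 1) p = 0) (kₛt : Kₛᵀ * What0 r (m + 1) p = 0)
    (kₜ : Kₜ * What0 r (m + 1) p = 0) (kₜt : Kₜᵀ * What0 r (m + 1) p = 0)
    (kₛₜ : Kₛₜ * What0 r (m + 1) p = 0) (kₛₜt : Kₛₜᵀ * What0 r (m + 1) p = 0)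
    (qₛ : Qₛ * What0 r (m + 1) p = 0) (qₜ : Qₜ * What0 r (m + 1) p = 0) (qₛₜ : Qₛₜ * What0 r (m + 1) p = 0) :
    hessT ((kkt (Khat (d := 3) (m + 1) p) (Matrix.fromRows (Qhat (d := 3) (m + 1) p) (tauT (toSite r) (m + 1) p)))⁻¹.submatrix
          (Sum.map id Sum.inl) (Sum.map id Sum.inl)) (kkt Kₛ Qₛ) (kkt Kₜ Qₜ) (kkt Kₛₜ Qₛₜ)
      + hessT ((What0 r (m + 1) p)ᵀ
            * ((Nᵀ * Lhat ((m + 1) * p) * (DhatS m p)ᵀ)ᵀ * ((2 : ℝ) • (Nᵀ * Lhat ((m + 1) * p) * Lhat ((m + 1) * p) * N)⁻¹)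
                * (Nᵀ * Lhat ((m + 1) * p) * (DhatS m p)ᵀ))
            * What0 r (m + 1) p)⁻¹
          ((What0 r (m + 1) p)ᵀ
            * gram₁ (Nᵀ * Lhat ((m + 1) * p) * (DhatS m p)ᵀ) Tₛ ((2 : ℝ) • (Nᵀ * Lhat ((m + 1) * p) * Lhat ((m + 1) * p) * N)⁻¹) Aₛ
            * What0 r (m + 1) p)
          ((What0 r (m + 1) p)ᵀ
            * gram₁ (Nᵀ * Lhat ((m + 1) * p) * (DhatS m p)ᵀ) Tₜ ((2 : ℝ) • (Nᵀ * Lhat ((m + 1) * p) * Lhat ((m + 1) * p) * N)⁻¹) Aₜ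
            * What0 r (m + 1) p)
          ((What0 r (m + 1) p)ᵀ
            * gramMix (Nᵀ * Lhat ((m + 1) * p) * (DhatS m p)ᵀ) Tₛ Tₜ Tₛₜ
                ((2 : ℝ) • (Nᵀ * Lhat ((m + 1) * p) * Lhat ((m + 1) * p) * N)⁻¹) Aₛ Aₜ Aₛₜ
            * What0 r (m + 1) p)
    = hessT (blocksHat p (sortK (m + 1) (NlegRoad m a)))
        (kkt (Kₛ + gram₁ (Nᵀ * Lhat ((m + 1) * p) * (DhatS m p)ᵀ) Tₛ
          ((2 : ℝ) • (Nᵀ * Lhat ((m + 1) * p) * Lhat ((m + 1) * p) * N)⁻¹) Aₛ) Qₛ)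
        (kkt (Kₜ + gram₁ (Nᵀ * Lhat ((m + 1) * p) * (DhatS m p)ᵀ) Tₜ
          ((2 : ℝ) • (Nᵀ * Lhat ((m + 1) * p) * Lhat ((m + 1) * p) * N)⁻¹) Aₜ) Qₜ)
        (kkt (Kₛₜ + gramMix (Nᵀ * Lhat ((m + 1) * p) * (DhatS m p)ᵀ) Tₛ Tₜ Tₛₜ
          ((2 : ℝ) • (Nᵀ * Lhat ((m + 1) * p) * Lhat ((m + 1) * p) * N)⁻¹) Aₛ Aₜ Aₛₜ) Qₛₜ) := by
  -- abbreviations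
  set W₀ := What0 r (m + 1) p with hW₀
  set T₀ : Matrix (CombRows (toSite r) (m + 1) p) (I 3 (m + 1) p) ℝ := Nᵀ * Lhat ((m + 1) * p) * (DhatS m p)ᵀ with hT₀
  set A₀ : Matrix (CombRows (toSite r) (m + 1) p) (CombRows (toSite r) (m + 1) p) ℝ :=
    (2 : ℝ) • (Nᵀ * Lhat ((m + 1) * p) * Lhat ((m + 1) * p) * N)⁻¹ with hA₀
  set τ := tauT (toSite r) (m + 1) p with hτ
  -- the zeroth-order letters, all by name
  have hτW : τ * W₀ = 1 := tauT_mul_What0 r (m + 1) p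
  have a0 : Khat (d := 3) (m + 1) p * W₀ = 0 := Khat_mul_What0 r (m + 1) p hr
  have a0t : (Khat (d := 3) (m + 1) p)ᵀ * W₀ = 0 := Khat_transpose_mul_What0 r (m + 1) p hr
  have b0 : Qhat (d := 3) (m + 1) p * W₀ = 0 := Qhat_mul_What0 r (m + 1) p hr
  have hτ' : (τ * W₀).det ≠ 0 := by rw [hτW, Matrix.det_one]; exact one_ne_zero
  have hT : (T₀ * W₀).det ≠ 0 := by
    rw [hW]; exact det_coframe_mul_basis_road_ne_zero m p ha hN hNinj
  have hA : A₀.det ≠ 0 := det_weightA_road_ne_zero m p ha hN hNinj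
  have hM : (kkt (Khat (d := 3) (m + 1) p) (Matrix.fromRows (Qhat (d := 3) (m + 1) p) τ)).det ≠ 0 := (isUnit_det_MT hr p).ne_zero
  -- K-TA4G (R2), mixed, with all `W`-jets and the unused pure second jets set to zero
  have h := hessT_gramTransfer_jets (Khat (d := 3) (m + 1) p) Kₛ Kₜ 0 0 Kₛₜ (Qhat (d := 3) (m + 1) p) Qₛ Qₜ 0 0 Qₛₜ
    T₀ Tₛ Tₜ 0 0 Tₛₜ A₀ Aₛ Aₜ 0 0 Aₛₜ W₀ 0 0 0 0 0 τ a0 a0t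
    (by rw [Matrix.mul_zero, add_zero, kₛ]) (by rw [Matrix.mul_zero, add_zero, kₛt])
    (by rw [Matrix.mul_zero, add_zero, kₜ]) (by rw [Matrix.mul_zero, add_zero, kₜt])
    (by rw [Matrix.zero_mul, Matrix.mul_zero, Matrix.mul_zero, smul_zero, add_zero, add_zero])
    (by rw [Matrix.transpose_zero, Matrix.zero_mul, Matrix.mul_zero, Matrix.mul_zero, smul_zero, add_zero, add_zero])
    (by rw [Matrix.zero_mul, Matrix.mul_zero, Matrix.mul_zero, smul_zero, add_zero, add_zero])
    (by rw [Matrix.transpose_zero, Matrix.zero_mul, Matrix.mul_zero, Matrix.mul_zero, smul_zero, add_zero, add_zero])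
    (by rw [Matrix.mul_zero, Matrix.mul_zero, Matrix.mul_zero, add_zero, add_zero, add_zero, kₛₜ])
    (by rw [Matrix.mul_zero, Matrix.mul_zero, Matrix.mul_zero, add_zero, add_zero, add_zero, kₛₜt])
    b0 (by rw [Matrix.mul_zero, add_zero, qₛ]) (by rw [Matrix.mul_zero, add_zero, qₜ])
    (by rw [Matrix.zero_mul, Matrix.mul_zero, Matrix.mul_zero, smul_zero, add_zero, add_zero])
    (by rw [Matrix.zero_mul, Matrix.mul_zero, Matrix.mul_zero, smul_zero, add_zero, add_zero])
    (by rw [Matrix.mul_zero, Matrix.mul_zero, Matrix.mul_zero, add_zero, add_zero, add_zero, qₛₜ])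
    hτ' hT hA hM
  have hinv : (kkt (Khat (d := 3) (m + 1) p + T₀ᵀ * A₀ * T₀) (Qhat (d := 3) (m + 1) p))⁻¹ = blocksHat p (sortK (m + 1) (NlegRoad m a)) :=
    inv_kkt_gram_eq_blocksHat m p ha hGa hN hNinj
  rw [gram₁_zero_basis, gram₁_zero_basis, gramMix_zero_basis, gram₀_eq, gram₀_eq, hinv] at h
  simp only [Matrix.mul_zero, hessT_zero_jets, mul_zero, add_zero] at h
  exact h

/-! ## §3 The same with the basis facts discharged at `N := N̂` («K-TB3b-N») -/

/-- [folklore] **TB5-1 AT THE CANONICAL COMB BASIS `N̂`**: `hessT_transfer_road` with `hN`, `hNinj`, `hW` DISCHARGED by `TorusGaugeBasisKernel`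
(`Nhat_range`, `Nhat_injective`, `What0_eq_DhatS_mul_Nhat`).  Displayed: the table jets with their kinematic Ward letters, the weight jets, `Spr Ga`. -/
theorem hessT_transfer_road_Nhat (ha : 0 < a) (hGa : Spr (GluonLeg.Ga (m + 1) a)) (hr : r ∈ box 4 (m + 1))
    (Kₛ Kₜ Kₛₜ : Matrix (I 3 (m + 1) p) (I 3 (m + 1) p) ℝ) (Qₛ Qₜ Qₛₜ : Matrix (J 3 p) (I 3 (m + 1) p) ℝ)
    (Tₛ Tₜ Tₛₜ : Matrix (CombRows (toSite r) (m + 1) p) (I 3 (m + 1) p) ℝ)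
    (Aₛ Aₜ Aₛₜ : Matrix (CombRows (toSite r) (m + 1) p) (CombRows (toSite r) (m + 1) p) ℝ)
    (kₛ : Kₛ * What0 r (m + 1) p = 0) (kₛt : Kₛᵀ * What0 r (m + 1) p = 0)
    (kₜ : Kₜ * What0 r (m + 1) p = 0) (kₜt : Kₜᵀ * What0 r (m + 1) p = 0)
    (kₛₜ : Kₛₜ * What0 r (m + 1) p = 0) (kₛₜt : Kₛₜᵀ * What0 r (m + 1) p = 0)
    (qₛ : Qₛ * What0 r (m + 1) p = 0) (qₜ : Qₜ * What0 r (m + 1) p = 0) (qₛₜ : Qₛₜ * What0 r (m + 1) p = 0) :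
    hessT ((kkt (Khat (d := 3) (m + 1) p) (Matrix.fromRows (Qhat (d := 3) (m + 1) p) (tauT (toSite r) (m + 1) p)))⁻¹.submatrix
          (Sum.map id Sum.inl) (Sum.map id Sum.inl)) (kkt Kₛ Qₛ) (kkt Kₜ Qₜ) (kkt Kₛₜ Qₛₜ)
      + hessT ((What0 r (m + 1) p)ᵀ
            * (((Nhat r (m + 1) p)ᵀ * Lhat ((m + 1) * p) * (DhatS m p)ᵀ)ᵀ
                * ((2 : ℝ) • ((Nhat r (m + 1) p)ᵀ * Lhat ((m + 1) * p) * Lhat ((m + 1) * p) * Nhat r (m + 1) p)⁻¹)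
                * ((Nhat r (m + 1) p)ᵀ * Lhat ((m + 1) * p) * (DhatS m p)ᵀ))
            * What0 r (m + 1) p)⁻¹
          ((What0 r (m + 1) p)ᵀ
            * gram₁ ((Nhat r (m + 1) p)ᵀ * Lhat ((m + 1) * p) * (DhatS m p)ᵀ) Tₛ
                ((2 : ℝ) • ((Nhat r (m + 1) p)ᵀ * Lhat ((m + 1) * p) * Lhat ((m + 1) * p) * Nhat r (m + 1) p)⁻¹) Aₛ
            * What0 r (m + 1) p)
          ((What0 r (m + 1) p)ᵀ
            * gram₁ ((Nhat r (m + 1) p)ᵀ * Lhat ((m + 1) * p) * (DhatS m p)ᵀ) Tₜ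
                ((2 : ℝ) • ((Nhat r (m + 1) p)ᵀ * Lhat ((m + 1) * p) * Lhat ((m + 1) * p) * Nhat r (m + 1) p)⁻¹) Aₜ
            * What0 r (m + 1) p)
          ((What0 r (m + 1) p)ᵀ
            * gramMix ((Nhat r (m + 1) p)ᵀ * Lhat ((m + 1) * p) * (DhatS m p)ᵀ) Tₛ Tₜ Tₛₜ
                ((2 : ℝ) • ((Nhat r (m + 1) p)ᵀ * Lhat ((m + 1) * p) * Lhat ((m + 1) * p) * Nhat r (m + 1) p)⁻¹) Aₛ Aₜ Aₛₜ
            * What0 r (m + 1) p)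
    = hessT (blocksHat p (sortK (m + 1) (NlegRoad m a)))
        (kkt (Kₛ + gram₁ ((Nhat r (m + 1) p)ᵀ * Lhat ((m + 1) * p) * (DhatS m p)ᵀ) Tₛ
          ((2 : ℝ) • ((Nhat r (m + 1) p)ᵀ * Lhat ((m + 1) * p) * Lhat ((m + 1) * p) * Nhat r (m + 1) p)⁻¹) Aₛ) Qₛ)
        (kkt (Kₜ + gram₁ ((Nhat r (m + 1) p)ᵀ * Lhat ((m + 1) * p) * (DhatS m p)ᵀ) Tₜ
          ((2 : ℝ) • ((Nhat r (m + 1) p)ᵀ * Lhat ((m + 1) * p) * Lhat ((m + 1) * p) * Nhat r (m + 1) p)⁻¹) Aₜ) Qₜ)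
        (kkt (Kₛₜ + gramMix ((Nhat r (m + 1) p)ᵀ * Lhat ((m + 1) * p) * (DhatS m p)ᵀ) Tₛ Tₜ Tₛₜ
          ((2 : ℝ) • ((Nhat r (m + 1) p)ᵀ * Lhat ((m + 1) * p) * Lhat ((m + 1) * p) * Nhat r (m + 1) p)⁻¹) Aₛ Aₜ Aₛₜ) Qₛₜ) :=
  hessT_transfer_road m p ha hGa hr (Nhat_range r m p hr) (Nhat_injective r (m + 1) p hr) (What0_eq_DhatS_mul_Nhat r m p hr)
    Kₛ Kₜ Kₛₜ Qₛ Qₜ Qₛₜ Tₛ Tₜ Tₛₜ Aₛ Aₜ Aₛₜ kₛ kₛt kₜ kₜt kₛₜ kₛₜt qₛ qₜ qₛₜ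

end Summit.QuantumFields.BalabanUV.Beta.D1BFx.KTransferTorus

end
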